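import Summits.BirchSwinnertonDyer.BirchSwinnertonDyer.Theorems.KimAtThreeDeepUpperNonAdditiveRows
import HarnessLib

/-!
# Route `KimAtThreeKolyvagin` (rung W2), crux `DeepUpperAtThreeOffKatoStratum` (item 19562): the
# MANIN-FREE bridge, the additive potentially-good rows from Kato 14.5 (3) by name, and the crux BY
# NAME modulo two typed residuals

Cell `bsd-addord`, seat `bsd-addord-w2-c5` (gen 0), item `stmt-BirchSwinnertonDyer-19562` (stubs
`stub_nonAdditive` — previous file `KimAtThreeDeepUpperNonAdditiveRows` — and `stub_additiveDefect`).
Theorems only; every printed input is a hypothesis BY NAME; nothing asserted; the crux stays open.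

THE POINT.  For the UPPER inequality `s + d ≤ a` (`s = ord₃ #Ш(3)`, `d = ∂^{(∞)}_{deep}(δ̃)`,
`a = ∂⁽⁰⁾(δ̃) = ord₃ [0]⁺_f`) the Manin constant is NOT an obstruction: at a LATTICE-OPTIMAL datum `D`
(`Λ_E = c·Λ_f`, `c ∈ ℤ`) one has `Ω(E) = |c|·Ω⁺_f`, so `L(E,1)/Ω(E) = [0]⁺_f/|c|` and every printed
bound `m ≤ ord₃(L(E,1)/Ω(E))` gives `m ≤ a − v₃(c) ≤ a` — the `3`-adic UNIT transfer `hper` of the cell's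
rungs (hence `3 ∤ c_D`, hence Mazur / the Kato-stratum clause `3 ∤ c_D`) is needed only for the LOWER
direction.  Consequences for crux 19562 (optimal datum `D₀` at `N = N_E`, analytic rank `0`, tower onto):

* §1 `natCast_le_kuriharaPartial_zero_of_le_padicValRat_of_integralTransfer` — the bridge of
  `KimAtThreeKolyvaginDeepUpperRung` with `|u|_p = 1` weakened to `u ≠ 0`, `ord_p u ≥ 0`;
  `integralTransfer_of_optimal` — every lattice-optimal datum supplies such a `u = |c_D|`.
* §2 `sha_add_tamagawa_le_kuriharaPartial_zero_of_missingUpperBoundAt_of_optimal` — Miller's upper half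
  `MissingUpperBoundAt W p` ⟹ `s + v_p(∏ c_ℓ) ≤ a` at `f = D.f`, NO Manin / period hypothesis;
  `…_of_kato2004TamagawaExact_of_optimal` — the same on every ADDITIVE POTENTIALLY-GOOD tower row from
  Kato Thm. 14.5 (3) + Prop. 14.16 (2) Tamagawa-exact (`hKato`, PUB), for ANY `c₃`, ANY `#E(ℚ₃)[3]`,
  ANY Manin constant — i.e. on the whole defect stratum of `stub_additiveDefect` except its potentially
  multiplicative rows; `deepUpper_conclusion_of_sha_add_tamagawa_le_of_deepInfty_le_tamagawa` — then the
  crux's conclusion ⟸ (DD) `d ≤ v₃(∏ c_ℓ)`.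
* §3 ★ `stub_additiveDefect_potGood_of_kato2004TamagawaExact_of_deepInfty_le_tamagawa` — the registered
  stub `stub_additiveDefect` VERBATIM on its potentially-good rows (`0 ≤ v₃ j`), from `hKato` + (DD) at the
  row alone.
* §4 ★ `deepUpperAtThreeOffKatoStratum_of_facts_of_missingUpperBoundAt_of_deepInfty_le_tamagawa` — the
  crux `DeepUpperAtThreeOffKatoStratum` BY NAME from SIX named facts (Yan–Zhu 2026 Thm 4.15, Wuthrich
  2014 L20, Skinner 2016 Thm C, modularity, GZK, Kato 14.5 (3) Tamagawa-exact) and TWO DISPLAYED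
  residual families: (U) Miller's upper half `MissingUpperBoundAt W 3` on the tower rows of analytic rank
  `0` in the three sub-strata with no `BSD₃`/Kato bound in the tree — good SUPERSINGULAR `3`,
  multiplicative `3` WITHOUT (ram), additive POTENTIALLY MULTIPLICATIVE `3` —, and (DD) the deep
  Tamagawa-defect bound `∂^{(∞)}_{deep}(δ̃) ≤ v₃(∏ c_ℓ)` on the crux's rows (the `≤` half of Kim's
  Conj. 1.10 in its deep reading; OPEN; by `KimAtThreeDeepUpperNonAdditiveRows` it is also NECESSARY on
  every `BSD₃` row).  This is the typed obstruction of item 19562.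
[cite: Kato2004Asterisque, Thm. 14.5 (3) (p. 236), Prop. 14.16 (2) (p. 244), §14.8 (p. 238)]
[cite: CremonaAlgorithms1997, §2.8 (p. 26)] [cite: EdixhovenManin1991, Prop. 2] [cite: Miller2011LMS, Def. 1.1]
[cite: YanZhu2024MainConjNonCM, Thm. 4.15 (§4.6)] [cite: Skinner2016PacificMC, Thm. C (§1)]
[cite: Kim2022StructureSelmer, §1.5.1, Conj. 1.10 (PDF pp. 7–8)] [cite: Kim2025RefinedTNC, Thm. 1.1]
-/

set_option autoImplicit false
-- the Theorems namespace of a single-conjunct summit repeats the summit name by design (D-0017)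
set_option linter.dupNamespace false

noncomputable section

open scoped MatrixGroups ModularForm Classical

open CongruenceSubgroup WeierstrassCurve Literature.NumberTheory.EllipticCurves
  Literature.NumberTheory.EllipticCurves.ModularForms
  Literature.NumberTheory.EllipticCurves.Rank1Residual
  Literature.NumberTheory.EllipticCurves.Rank1Residual.Typed

namespace Summit.BirchSwinnertonDyer.BirchSwinnertonDyer.Theorems.KimAtThreeDeepUpperOffStratumManinFree

open Summit.BirchSwinnertonDyer.Rank1Residual
open Summit.BirchSwinnertonDyer.Rank1Residual.Additive
open Summit.BirchSwinnertonDyer.Rank1Residual.Supersingular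
open Summit.BirchSwinnertonDyer.BirchSwinnertonDyer.Theses.KimAtThreeKolyvagin
open Summit.BirchSwinnertonDyer.BirchSwinnertonDyer.Theorems.KimAtThreeKolyvaginDeepUpperRung
open Summit.BirchSwinnertonDyer.BirchSwinnertonDyer.Theorems.KimAtThreeKolyvaginUnitLevelOneRungs
open Summit.BirchSwinnertonDyer.BirchSwinnertonDyer.Theorems.KimAtThreeKolyvaginCertificateDictionary
open Summit.BirchSwinnertonDyer.BirchSwinnertonDyer.Theorems.KimAtThreeDeepLowerNonAdditiveRows
open Summit.BirchSwinnertonDyer.BirchSwinnertonDyer.Theorems.KimAtThreeDeepUpperNonAdditiveRows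

/-! ### §1 The Manin-free bridge: BSD currency ⇒ `∂`-currency with an INTEGRAL period transfer -/

section Bridge

variable (W : WeierstrassCurve ℚ) [W.IsElliptic] [W.IsGloballyMinimal] (p : ℕ) [Fact p.Prime]
  {N : ℕ} [NeZero N] (f : CuspForm (Gamma0 N) 2)

/-- **BSD currency ⇒ `∂`-currency, INTEGRAL transfer.**  For odd `p`, `E[p]` irreducible, `f` the newform
of `W` and `Ω(W) = u · Ω⁺_f` with `u ≠ 0`, `ord_p u ≥ 0` (e.g. `u = |c_D|` for a lattice-optimal datum):
if `L(E,1)/Ω(W) = q` and `m ≤ ord_p q` then `m ≤ ∂⁽⁰⁾(δ̃)` — indeed `q = [0]⁺_f/u`, so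
`ord_p q = ∂⁽⁰⁾ − ord_p u ≤ ∂⁽⁰⁾`.  (`KimAtThreeKolyvaginDeepUpperRung.natCast_le_kuriharaPartial_zero_of_le_padicValRat`
is the case `ord_p u = 0`.) [cite: Kim2022StructureSelmer, §1.4.3 and §1.5.1 (PDF p. 7)] [cite: CremonaAlgorithms1997, §2.8 (p. 26)] -/
theorem natCast_le_kuriharaPartial_zero_of_le_padicValRat_of_integralTransfer (hp2 : p ≠ 2)
    (hirr : W.HasIrreducibleModPGaloisRep p) (hf : IsNewformOf W f)
    (hper : ∃ u : ℚ, u ≠ 0 ∧ 0 ≤ padicValRat p u ∧ W.realPeriodRat = u * plusPeriod f)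
    {q : ℚ} (hq : W.entireLFunction 1 / (W.realPeriodRat : ℂ) = (q : ℂ)) {m : ℕ}
    (hm : (m : ℤ) ≤ padicValRat p q) : (m : ℕ∞) ≤ kuriharaPartial W p f 0 := by
  by_cases h0 : ratPlusSymbol f 0 = 0
  · rw [kuriharaPartial_zero_eq_top_of_ratPlusSymbol_eq_zero W p f h0]
    exact le_top
  · have hint0 : ¬ p ∣ (ratPlusSymbol f 0).den :=
      not_dvd_den_of_norm_ratCast_le_one (norm_ratPlusSymbol_le_one_of_irreducible hp2 hf hirr 0)
    have hΩf : 0 < plusPeriod f := IsNewform0.plusPeriod_pos_holds hf.1 hf.coeffField_eq_bot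
    obtain ⟨u, hu0, hvu, hΩ⟩ := hper
    -- `q = [0]⁺_f / u`
    have hq' : q = ratPlusSymbol f 0 / u := by
      have hu' : (u : ℂ) ≠ 0 := by exact_mod_cast hu0
      have hΩf' : ((plusPeriod f : ℝ) : ℂ) ≠ 0 := by exact_mod_cast hΩf.ne'
      have h1 : (q : ℂ) = ((ratPlusSymbol f 0 / u : ℚ) : ℂ) := by
        rw [← hq, hf.entireLFunction_one_eq, hΩ]
        push_cast
        field_simp
      exact_mod_cast h1
    have hval : padicValRat p q ≤ padicValRat p (ratPlusSymbol f 0) := by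
      rw [hq', padicValRat.div h0 hu0]
      linarith
    rw [kuriharaPartial_zero, kuriharaDivIndex_one_eq W p f hint0 h0]
    have hm' := hm.trans hval
    have hnat : m ≤ (padicValRat p (ratPlusSymbol f 0)).toNat := by omega
    exact_mod_cast hnat

omit [W.IsGloballyMinimal] [Fact p.Prime] in
/-- **Every lattice-optimal datum gives an INTEGRAL period transfer**: `Ω(W) = |c_D| · Ω⁺_{D.f}` with
`c_D ∈ ℤ ∖ {0}` (Cremona §2.8; `X4.realPeriodRat_eq_abs_maninConstant_mul_plusPeriod_of_optimal`), so
`u = |c_D|` has `u ≠ 0` and `ord_p u ≥ 0` for EVERY prime — no Manin hypothesis.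
[cite: CremonaAlgorithms1997, §2.8 (p. 26)] [cite: EdixhovenManin1991, Prop. 2] -/
theorem integralTransfer_of_optimal (D : ModularParametrizationData W N)
    (hopt : ∀ z ∈ D.L.lattice, ∃ w ∈ periodLattice D.f, z = D.c * w) :
    ∃ u : ℚ, u ≠ 0 ∧ 0 ≤ padicValRat p u ∧ W.realPeriodRat = u * plusPeriod D.f := by
  have hΩ : W.realPeriodRat = ((|D.c| : ℤ) : ℚ) * plusPeriod D.f := by
    rw [X4.realPeriodRat_eq_abs_maninConstant_mul_plusPeriod_of_optimal D hopt]
    push_cast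
    rfl
  refine ⟨((|D.c| : ℤ) : ℚ), fun h => ?_, ?_, hΩ⟩
  · have hpos : (0 : ℝ) < W.realPeriodRat := W.realPeriodRat_pos_holds
    rw [hΩ, h] at hpos
    simp at hpos
  · rw [padicValRat.of_int]
    exact_mod_cast Nat.zero_le _

end Bridge

/-! ### §2 `s + v_p(∏ c_ℓ) ≤ ∂⁽⁰⁾` at an optimal datum, Manin-free: from Miller's upper half / from Kato -/

section UpperBounds

variable (W : WeierstrassCurve ℚ) [W.IsElliptic] [W.IsGloballyMinimal] (p : ℕ) [Fact p.Prime]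
  {N : ℕ} [NeZero N]

/-- **Miller's UPPER half ⟹ `ord_p #Ш(E/ℚ)(p) + v_p(∏ c_ℓ) ≤ ∂⁽⁰⁾(δ̃)` at `f = D.f` for ANY lattice-optimal
datum `D` of `W`** (odd `p`, `E[p]` irreducible, analytic rank `0`, GZK) — the Manin-free form of w2-c4's
`KimAtThreeShallowEqDeepOffStratumSockets.sha_add_tamagawa_le_kuriharaPartial_zero_of_missingUpperBoundAt`:
`#Ш_an = t·#tors²/∏ c_ℓ` with `t = L(E,1)/Ω(W) = [0]⁺_f/|c_D|`.
[cite: Miller2011LMS, Def. 1.1] [cite: CremonaAlgorithms1997, §2.8 (p. 26)] -/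
theorem sha_add_tamagawa_le_kuriharaPartial_zero_of_missingUpperBoundAt_of_optimal
    (hGZK : rank_eq_analyticRank_of_analyticRank_le_one) (hp2 : p ≠ 2)
    (hirr : W.HasIrreducibleModPGaloisRep p) (D : ModularParametrizationData W N)
    (hopt : ∀ z ∈ D.L.lattice, ∃ w ∈ periodLattice D.f, z = D.c * w)
    (hord : kuriharaVanishingOrder W p D.f = 0) (hup : MissingUpperBoundAt W p) :
    ((padicValNat p (Nat.card (AddCommGroup.primaryComponent W.sha p)) +
        padicValNat p W.tamagawaProduct : ℕ) : ℕ∞) ≤ kuriharaPartial W p D.f 0 := by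
  have hf : IsNewformOf W D.f := D.isNewformOf
  have h0 : ratPlusSymbol D.f 0 ≠ 0 :=
    ratPlusSymbol_zero_ne_zero_of_kuriharaVanishingOrder_eq_zero W p D.f hord
  have hL : W.entireLFunction 1 ≠ 0 := hf.entireLFunction_one_ne_zero_of_ratPlusSymbol_zero_ne_zero h0
  have hr0 : W.analyticRank = 0 := analyticRank_eq_zero_of_entireLFunction_one_ne_zero hL
  obtain ⟨-, hfin⟩ := hGZK W (by rw [hr0]; exact zero_le_one)
  haveI : Finite W.sha := hfin
  obtain ⟨u, hu0, hvu, hΩ⟩ := integralTransfer_of_optimal W p D hopt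
  have hΩf : 0 < plusPeriod D.f := IsNewform0.plusPeriod_pos_holds hf.1 hf.coeffField_eq_bot
  -- the rational witness `t = [0]⁺_f / u = L(E,1)/Ω(W)`
  have ht : W.entireLFunction 1 / (W.realPeriodRat : ℂ) = ((ratPlusSymbol D.f 0 / u : ℚ) : ℂ) := by
    have hu' : (u : ℂ) ≠ 0 := by exact_mod_cast hu0
    have hΩf' : ((plusPeriod D.f : ℝ) : ℂ) ≠ 0 := by exact_mod_cast hΩf.ne'
    rw [hf.entireLFunction_one_eq, hΩ]
    push_cast
    field_simp
  have ht0 : ratPlusSymbol D.f 0 / u ≠ 0 := div_ne_zero h0 hu0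
  obtain ⟨q, hq, hv⟩ := hup
  have hqt : q = ratPlusSymbol D.f 0 / u * (W.torsionOrder : ℚ) ^ 2 / (W.tamagawaProduct : ℚ) := by
    have h1 := hq.symm.trans (shaAn_eq_of_analyticRank_eq_zero W hGZK hr0 ht)
    exact_mod_cast h1
  have hsha : padicValNat p (Nat.card (AddCommGroup.primaryComponent W.sha p)) =
      padicValNat p W.shaOrder := by
    unfold WeierstrassCurve.shaOrder
    exact padicValNat_card_addPrimaryComponent p
  rw [hqt, padicValRat_shaAn_witness W p hirr ht0, ← hsha] at hv
  have hv' : ((padicValNat p (Nat.card (AddCommGroup.primaryComponent W.sha p)) +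
      padicValNat p W.tamagawaProduct : ℕ) : ℤ) ≤ padicValRat p (ratPlusSymbol D.f 0 / u) := by
    rw [Nat.cast_add]
    linarith
  exact natCast_le_kuriharaPartial_zero_of_le_padicValRat_of_integralTransfer W p D.f hp2 hirr hf
    ⟨u, hu0, hvu, hΩ⟩ ht hv'

/-- **Kato Thm. 14.5 (3) Tamagawa-exact ⟹ `ord₃ #Ш(E/ℚ)(3) + v₃(∏ c_ℓ) ≤ ∂⁽⁰⁾(δ̃)` at `f = D.f` for ANY
lattice-optimal datum `D`, on every ADDITIVE POTENTIALLY-GOOD tower row with `Ш` finite and `ord(δ̃) = 0`**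
— for any `c₃`, any `#E(ℚ₃)[3]`, any Manin constant (the Manin-free re-reading of
`KimAtThreeKolyvaginDeepUpperRung.sha_add_tamagawa_le_kuriharaPartial_zero_of_kato2004TamagawaExact`).
[cite: Kato2004Asterisque, Thm. 14.5 (3) (p. 236), Prop. 14.16 (2) (p. 244), §14.8 (p. 238)]
[cite: GreenbergLNM1716, Prop. 4.13, §4] [cite: CremonaAlgorithms1997, §2.8 (p. 26)] -/
theorem sha_add_tamagawa_le_kuriharaPartial_zero_of_kato2004TamagawaExact_of_optimal
    (hKato : Kato2004.rankZero_padicValNat_sha_add_padicValNat_tamagawa_le_of_additive_potGood_of_imageContainsSL2)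
    (htower : ∀ n : ℕ, W.HasSurjectiveModNGaloisRep (3 ^ n : ℕ)) (hfin : Finite W.sha)
    (D : ModularParametrizationData W N)
    (hopt : ∀ z ∈ D.L.lattice, ∃ w ∈ periodLattice D.f, z = D.c * w)
    (hord : kuriharaVanishingOrder W 3 D.f = 0)
    (hadd : haveI : Fact (Nat.Prime 3) := ⟨Nat.prime_three⟩; Addv W 3) (hpot : 0 ≤ padicValRat 3 W.j) :
    ((padicValNat 3 (Nat.card (AddCommGroup.primaryComponent W.sha 3)) +
        padicValNat 3 W.tamagawaProduct : ℕ) : ℕ∞) ≤ kuriharaPartial W 3 D.f 0 := by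
  haveI : Fact (Nat.Prime 3) := ⟨Nat.prime_three⟩
  have hf : IsNewformOf W D.f := D.isNewformOf
  have h0 : ratPlusSymbol D.f 0 ≠ 0 :=
    ratPlusSymbol_zero_ne_zero_of_kuriharaVanishingOrder_eq_zero W 3 D.f hord
  obtain ⟨q, hq, hle⟩ := hKato W 3 (by norm_num) hadd.1 hadd.2 hpot
    (Kato2004.imageContainsSL2_of_forall_hasSurjectiveModNGaloisRep W 3 htower)
    (hf.entireLFunction_one_ne_zero_of_ratPlusSymbol_zero_ne_zero h0) hfin
  exact natCast_le_kuriharaPartial_zero_of_le_padicValRat_of_integralTransfer W 3 D.f (by norm_num)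
    (hasIrreducibleModPGaloisRep_of_hasSurjectiveModNGaloisRep W 3 (by simpa using htower 1)) hf
    (integralTransfer_of_optimal W 3 D hopt) hq (by rw [Nat.cast_add]; exact hle)

omit [W.IsElliptic] [Fact p.Prime] [NeZero N] in
/-- **`s + c ≤ ∂⁽⁰⁾` ∧ (DD) `∂^{(∞)}_{deep} ≤ c` ⟹ the UPPER crux conclusion at the row** (`ℕ∞` bookkeeping).
[cite: Kim2022StructureSelmer, Conj. 1.10 (PDF p. 8), §1.5.1 (PDF p. 7)] -/
theorem deepUpper_conclusion_of_sha_add_le_of_deepInfty_le (f : CuspForm (Gamma0 N) 2) {c : ℕ}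
    (hK : ((padicValNat p (Nat.card (AddCommGroup.primaryComponent W.sha p)) + c : ℕ) : ℕ∞) ≤
      kuriharaPartial W p f 0)
    (hDD : kuriharaPartialDeepInfty W p f ≤ (c : ℕ∞)) :
    ∃ d : ℕ, kuriharaPartialDeepInfty W p f = d ∧
      ((padicValNat p (Nat.card (AddCommGroup.primaryComponent W.sha p)) + d : ℕ) : ℕ∞) ≤
        kuriharaPartial W p f 0 := by
  obtain ⟨d, hd, hdle⟩ := ENat.le_coe_iff.mp hDD
  refine ⟨d, hd, le_trans ?_ hK⟩
  exact_mod_cast Nat.add_le_add_left hdle _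

end UpperBounds

/-! ### §3 The registered stub `stub_additiveDefect` on its potentially-good rows -/

/-- ★ **`stub_additiveDefect` of crux 19562 on its POTENTIALLY-GOOD rows, from Kato Thm. 14.5 (3)
Tamagawa-exact (`hKato`, PUB) and (DD) at the row alone** — binders of the registered stub VERBATIM
(the defect disjunction `3 ∣ c₃ ∨ #E(ℚ₃)[3] ≠ 1 ∨ 3 ∣ c_{D₀}` is carried and not even used: the upper
inequality is Manin-free, `t`-free and `c₃`-free), plus `0 ≤ v₃ j(E)` and (DD).  What separates this from
the registered stub: (DD), OPEN; and the additive potentially-MULTIPLICATIVE rows (`v₃ j < 0`), where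
the tree holds no `Ш`-bound beyond Kim–Nakamura's unit slice.
[cite: Kato2004Asterisque, Thm. 14.5 (3) (p. 236), Prop. 14.16 (2) (p. 244)] [cite: Kim2022StructureSelmer, Conj. 1.10 (PDF p. 8)] -/
theorem stub_additiveDefect_potGood_of_kato2004TamagawaExact_of_deepInfty_le_tamagawa
    (hKato : Kato2004.rankZero_padicValNat_sha_add_padicValNat_tamagawa_le_of_additive_potGood_of_imageContainsSL2) :
    ∀ (W₀ : WeierstrassCurve ℚ) [W₀.IsElliptic] [W₀.IsGloballyMinimal],
      (∀ n : ℕ, W₀.HasSurjectiveModNGaloisRep (3 ^ n : ℕ)) → Finite W₀.sha →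
      ∀ {N : ℕ} [NeZero N], N = W₀.conductorNorm ℤ →
      ∀ (D₀ : ModularParametrizationData W₀ N),
        (∀ z ∈ D₀.L.lattice, ∃ w ∈ periodLattice D₀.f, z = D₀.c * w) →
        (∀ (W₂ : WeierstrassCurve ℚ) [W₂.IsElliptic] (D₂ : ModularParametrizationData W₂ N),
          D₂.f = D₀.f → D₀.modularDegree ≤ D₂.modularDegree) →
        (∀ r : ℚ, ratPlusSymbol D₀.f r ≠ 0 → 0 ≤ padicValRat 3 (ratPlusSymbol D₀.f r)) →
        kuriharaVanishingOrder W₀ 3 D₀.f = 0 →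
        (haveI : Fact (Nat.Prime 3) := ⟨Nat.prime_three⟩; Addv W₀ 3) →
        (3 ∣ (W₀.baseChange ℚ_[3]).localTamagawaNumber ℤ_[3] ∨
          Nat.card {Q : (W₀.baseChange ℚ_[3]).toAffine.Point // (3 : ℕ) • Q = 0} ≠ 1 ∨
          (3 : ℤ) ∣ D₀.maninConstant) →
        -- potentially good, and (DD) at the row
        0 ≤ padicValRat 3 W₀.j →
        kuriharaPartialDeepInfty W₀ 3 D₀.f ≤ ((padicValNat 3 W₀.tamagawaProduct : ℕ) : ℕ∞) →
        ∃ d : ℕ, kuriharaPartialDeepInfty W₀ 3 D₀.f = d ∧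
          ((padicValNat 3 (Nat.card (AddCommGroup.primaryComponent W₀.sha 3)) + d : ℕ) : ℕ∞) ≤
            kuriharaPartial W₀ 3 D₀.f 0 := by
  intro W₀ _ _ htower hfin N _ _ D₀ hopt _ _ hord hadd _ hpot hDD
  exact deepUpper_conclusion_of_sha_add_le_of_deepInfty_le W₀ 3 D₀.f
    (sha_add_tamagawa_le_kuriharaPartial_zero_of_kato2004TamagawaExact_of_optimal W₀ hKato htower hfin
      D₀ hopt hord hadd hpot) hDD

/-! ### §4 The crux BY NAME, modulo the two typed residuals -/

/-- ★ **Crux `DeepUpperAtThreeOffKatoStratum` (item 19562) BY NAME from SIX named facts and TWO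
DISPLAYED residual families.**  Facts: Yan–Zhu 2026 Thm. 4.15 (`hYZ`), Wuthrich 2014 Lemma 20 (`hW20`),
Skinner 2016 Thm. C (`hSk`), modularity (`hmod`), GZK (`hGZK`), Kato Thm. 14.5 (3) Tamagawa-exact
(`hKato`).  Residuals: (U) Miller's upper half `MissingUpperBoundAt W 3` on the tower rows of analytic
rank `0` (with `Ш` finite) in the three sub-strata where the tree has no `Ш`-bound — good SUPERSINGULAR
`3`, multiplicative `3` WITHOUT (ram), additive POTENTIALLY MULTIPLICATIVE `3`; (DD) the deep
Tamagawa-defect bound `∂^{(∞)}_{deep}(δ̃) ≤ v₃(∏ c_ℓ)` on the crux's own rows (binders verbatim).  Row by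
row: `s + v₃(∏ c_ℓ) ≤ ∂⁽⁰⁾` at the optimal datum comes, Manin-free, from `BSDp W₀ 3` (rows C16 / C1), from
(U), or from `hKato`; (DD) closes.  The Kato-stratum exclusion is not used.
[cite: YanZhu2024MainConjNonCM, Thm. 4.15 (§4.6)] [cite: Wuthrich2014, Lemma 20 (p. 399)]
[cite: Skinner2016PacificMC, Thm. C (§1)] [cite: Kato2004Asterisque, Thm. 14.5 (3) (p. 236), Prop. 14.16 (2) (p. 244)]
[cite: Miller2011LMS, Def. 1.1] [cite: Kim2022StructureSelmer, Conj. 1.10 (PDF p. 8)] [cite: Kim2025RefinedTNC, Thm. 1.1] -/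
theorem deepUpperAtThreeOffKatoStratum_of_facts_of_missingUpperBoundAt_of_deepInfty_le_tamagawa
    (hYZ : YanZhu2026.thm415_padicValRat_bsd_rank_le_one)
    (hW20 : Wuthrich2014.lemma20_surjective_threeAdic_of_semistable)
    (hSk : Skinner2016.thmC_padicValRat_bsd_rank_zero)
    (hmod : hasEntireLFunction_rat) (hGZK : rank_eq_analyticRank_of_analyticRank_le_one)
    (hKato : Kato2004.rankZero_padicValNat_sha_add_padicValNat_tamagawa_le_of_additive_potGood_of_imageContainsSL2)
    (hU : ∀ (W : WeierstrassCurve ℚ) [W.IsElliptic] [W.IsGloballyMinimal],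
      (∀ n : ℕ, W.HasSurjectiveModNGaloisRep (3 ^ n : ℕ)) → Finite W.sha → W.analyticRank = 0 →
      ((W.HasGoodReductionAtPrime 3 ∧ (3 : ℤ) ∣ W.frobeniusTrace 3) ∨
        (W.HasMultiplicativeReductionAtPrime 3 ∧
          ¬ (haveI : Fact (Nat.Prime 3) := ⟨Nat.prime_three⟩; Ram W 3)) ∨
        ((haveI : Fact (Nat.Prime 3) := ⟨Nat.prime_three⟩; Addv W 3) ∧ padicValRat 3 W.j < 0)) →
      MissingUpperBoundAt W 3)
    (hDD : ∀ (W₀ : WeierstrassCurve ℚ) [W₀.IsElliptic] [W₀.IsGloballyMinimal],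
      (∀ n : ℕ, W₀.HasSurjectiveModNGaloisRep (3 ^ n : ℕ)) → Finite W₀.sha →
      ∀ {N : ℕ} [NeZero N], N = W₀.conductorNorm ℤ →
      ∀ (D₀ : ModularParametrizationData W₀ N),
        (∀ z ∈ D₀.L.lattice, ∃ w ∈ periodLattice D₀.f, z = D₀.c * w) →
        (∀ (W₂ : WeierstrassCurve ℚ) [W₂.IsElliptic] (D₂ : ModularParametrizationData W₂ N),
          D₂.f = D₀.f → D₀.modularDegree ≤ D₂.modularDegree) →
        (∀ r : ℚ, ratPlusSymbol D₀.f r ≠ 0 → 0 ≤ padicValRat 3 (ratPlusSymbol D₀.f r)) →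
        kuriharaVanishingOrder W₀ 3 D₀.f = 0 →
        ¬ ((haveI : Fact (Nat.Prime 3) := ⟨Nat.prime_three⟩; Addv W₀ 3) ∧
            ¬ 3 ∣ (W₀.baseChange ℚ_[3]).localTamagawaNumber ℤ_[3] ∧
            Nat.card {Q : (W₀.baseChange ℚ_[3]).toAffine.Point // (3 : ℕ) • Q = 0} = 1 ∧
            ¬ (3 : ℤ) ∣ D₀.maninConstant) →
        kuriharaPartialDeepInfty W₀ 3 D₀.f ≤ ((padicValNat 3 W₀.tamagawaProduct : ℕ) : ℕ∞)) :
    DeepUpperAtThreeOffKatoStratum := by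
  intro W₀ _ _ htower hfin N _ hN D₀ hopt hdeg hint hord hoff
  haveI : Fact (Nat.Prime 3) := ⟨Nat.prime_three⟩
  have hf : IsNewformOf W₀ D₀.f := D₀.isNewformOf
  have hsurj : Surj W₀ 3 := by
    have h := htower 1
    rw [pow_one] at h
    exact h
  have hirr : Irr W₀ 3 := hasIrreducibleModPGaloisRep_of_hasSurjectiveModNGaloisRep W₀ 3 hsurj
  have hr0 : W₀.analyticRank = 0 := analyticRank_eq_zero_of_kuriharaVanishingOrder_eq_zero W₀ D₀.f hf hord
  haveI : Finite W₀.sha := hfin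
  -- `s + v₃(∏ c_ℓ) ≤ ∂⁽⁰⁾` at the row, by cases on the reduction type at `3`
  have hK : ((padicValNat 3 (Nat.card (AddCommGroup.primaryComponent W₀.sha 3)) +
      padicValNat 3 W₀.tamagawaProduct : ℕ) : ℕ∞) ≤ kuriharaPartial W₀ 3 D₀.f 0 := by
    have viaUpper : MissingUpperBoundAt W₀ 3 →
        ((padicValNat 3 (Nat.card (AddCommGroup.primaryComponent W₀.sha 3)) +
          padicValNat 3 W₀.tamagawaProduct : ℕ) : ℕ∞) ≤ kuriharaPartial W₀ 3 D₀.f 0 := fun hup =>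
      sha_add_tamagawa_le_kuriharaPartial_zero_of_missingUpperBoundAt_of_optimal W₀ 3 hGZK (by norm_num)
        hirr D₀ hopt hord hup
    by_cases hgood : W₀.HasGoodReductionAtPrime 3
    · by_cases hord3 : (3 : ℤ) ∣ W₀.frobeniusTrace 3
      · exact viaUpper (hU W₀ htower hfin hr0 (Or.inl ⟨hgood, hord3⟩))
      · exact viaUpper (missingUpperBoundAt_three_of_goodOrd_of_towerSurj hYZ hW20 hmod hGZK W₀ htower
          hr0 hgood hord3)
    · by_cases hmult : W₀.HasMultiplicativeReductionAtPrime 3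
      · by_cases hram : Ram W₀ 3
        · exact viaUpper (missingUpperBoundAt_three_of_mult_of_ram hSk hmod hGZK W₀ htower hr0 hmult hram)
        · exact viaUpper (hU W₀ htower hfin hr0 (Or.inr (Or.inl ⟨hmult, hram⟩)))
      · have hadd : Addv W₀ 3 := ⟨hgood, hmult⟩
        by_cases hpot : 0 ≤ padicValRat 3 W₀.j
        · exact sha_add_tamagawa_le_kuriharaPartial_zero_of_kato2004TamagawaExact_of_optimal W₀ hKato
            htower hfin D₀ hopt hord hadd hpot
        · exact viaUpper (hU W₀ htower hfin hr0 (Or.inr (Or.inr ⟨hadd, lt_of_not_ge hpot⟩)))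
  exact deepUpper_conclusion_of_sha_add_le_of_deepInfty_le W₀ 3 D₀.f hK
    (hDD W₀ htower hfin hN D₀ hopt hdeg hint hord hoff)

end Summit.BirchSwinnertonDyer.BirchSwinnertonDyer.Theorems.KimAtThreeDeepUpperOffStratumManinFree

end
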